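import Mathlib
import Summits.MatrixMultiplication.Statement
import Summits.MatrixMultiplication.MatrixMultiplication.Theorems.GraphEquationsHorizontalRound
import Summits.MatrixMultiplication.MatrixMultiplication.Theorems.GraphEquationsFiniteOrder

/-!
# The free mixed dial `FreeReach` and its power calibration (`GraphEquations`, kernel M84)

Decomp-mm node «GraphEquations» (lens 5); attacked leaf `MultiplicityReduction` (stmt-MatrixMultiplication-27806);
target of the node, VERBATIM: `_root_.MatrixMultiplication`.  Helper only: no dial of the route changes, no cost
clause and no `EFM`/`KFC`-type dial is typed (critic g22 (9.1), dial discipline); this file types the FREE MIXED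
DIAL of NODE-g49 §3.1 together with its DECISION at `D = 4`, order `1` (critic g22 (9.1)(B), (9.3)).

THE DIAL.  Close a correct test system under the two COST-FREE first-order letters — horizontal derivations
`X_{U,V}` (M60a `hDer`: tangent to the graph, they kill the generators) and vertical derivations `D_γ` along
CONSTANT kernel fields `γ` of the current stage (M20 `derivC`) — and ask whether some word of length `≤ r`
reaches ideal-initial isolation of order `K` over some base pair: `FreeReach D r K`.  Length `0` is the order
dial (`freeReach_zero_iff`); vertical words are the kernel towers of M79 along constant fields
(`freeTowerSet_map_V`); `TowerReach` with arbitrary polynomial fields is incomparable.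

DECIDED HERE.  **`not_freeReach_pow : 2 ≤ e → ∀ r, ¬ FreeReach (2e) r (e − 1)`**, by the specimen
`RP_e(n) = {Σ_q a_q b_q · f_q} ∪ {f_q^e}` — the THETA ROW (private products `θ_q = a_q b_q`: the `a`- and the
`b`-variable AT position `q`) and the `e`-th powers; correct, degree `2e` (`exists_rpSystem`).  INVARIANT
(`freeTowerSet_subset_rpGood`): every free stage consists of `0`, powers `f_q^e` and row tests `Σ_q ρ_q f_q`
with at most `2^{length}` rows — `X_{U,V} row(ρ) = row(∂_{U,V} ρ)` (`hDer_rowTest`) and `X_{U,V} f^e = 0`;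
`D_γ` is legal on the theta row only if `Σ_q γ_q θ_q = 0`, i.e. `γ = 0` (`eq_zero_of_legal_rowTest_rpTheta`),
and then adjoins `0`.  CERTIFICATE: over `n = 2^r + 1` the `≤ 2^r < n²` rows have a common kernel vector
`u ≠ 0` at EVERY base pair (`exists_common_kernel`); along the jet `F = uX` every stage element is `O(X^e)`
(`rpGood_jet_dvd`), so no stage is isolated to order `< e` (M81 `not_idealInitIsolatedSet_of_jetCert`); tight:
`RP_e` is isolated to order `e` at height `0` (`exists_rpSystem`).  Hence **`not_freeReach_four_one :
∀ r, ¬ FreeReach 4 r 1`** (`RP_2`; length `0` is dead for every order, `not_freeReach_four_length_zero`, M71)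
and **`not_freeReach_six_two : ∀ r, ¬ FreeReach 6 r 2`** (`RP_3`; all `K ≤ 2`: the free alphabet cannot
carry an order-`≤ 2` conclusion at any degree `≥ 6`).

NOT DECIDED HERE.  The cell that matters at `D = 4`, **`FreeReach 4 r 2` (`r ≥ 1`), is OPEN** — `RP_2` is
order-`2` isolated at height `0`, and every other degree-`4` specimen of the lens-5 zoo falls to ONE horizontal
letter (NODE-g49 §4, M83); NODE-g50 has the paper analysis of order-`2` masking designs.  The engine claim
`FreeReach D r K ∧ K ≤ 2 ⇒ EquationsForceMultiplicationDeg D` (NODE-g49 §3.2, gap B1) is PAPER, not asserted.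

Sources: Leykin–Verschelde–Zhao, TCS 359 (2006) [doi:10.1016/j.tcs.2006.02.018] (deflation, kernel fields);
[BurgisserClausenShokrollahi1997, §4.1, §7.1 (Baur–Strassen), Problem 16.3]; this tree: M20 `GraphEquationsDerivations`,
M60a `GraphEquationsHorizontalDerivation`, M71 `GraphEquationsDegreeFourMasking`, M79 `GraphEquationsKernelTowers`,
M81 `GraphEquationsCubicLadder`, M83 `GraphEquationsHorizontalRound`.  No `sorry`.
-/

set_option linter.dupNamespace false

noncomputable section

namespace Summit.MatrixMultiplication.MatrixMultiplication.Theorems.GraphEquations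

open MvPolynomial Matrix Literature.Computability.AlgebraicComplexity Literature.Computability.AlgebraicComplexity.ArithCircuit

variable {n : ℕ}

/-! ## Free letters, free towers, the dial -/

/-- A FREE LETTER over `n × n`: the horizontal letter `H U V` (adjoin `X_{U,V} S`, M60a `hDer`) or the
vertical-constant letter `V γ` (adjoin `D_γ S` for the CONSTANT field `γ`, M20 `derivC`). -/
inductive FreeLetter (n : ℕ) : Type
  | H (U V : Vec n) : FreeLetter n
  | V (γ : Vec n) : FreeLetter n

/-- The constant coefficient field `q ↦ γ_q ∈ ℂ ⊆ ℂ[A,B]`. -/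
def constField (γ : Vec n) : Fin n × Fin n → MvPolynomial (MatMulVars n) ℂ := fun q => C (γ q)

namespace FreeLetter

/-- What a letter adjoins to the stage `S`. -/
def image : FreeLetter n → Set (MvPolynomial (GraphVars n) ℂ) → Set (MvPolynomial (GraphVars n) ℂ)
  | H U W, S => hDer U W '' S
  | V γ, S => derivC (constField γ) '' S

/-- LEGALITY of a letter at the stage `S`: horizontal letters are always legal (the field is tangent to the
graph, `hDer_mem_graphIdeal`); `V γ` is legal iff `γ` is a kernel field of `S` (`D_γ S ⊆ I(Γ)`). -/
def Legal : FreeLetter n → Set (MvPolynomial (GraphVars n) ℂ) → Prop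
  | H _ _, _ => True
  | V γ, S => ∀ t ∈ S, derivC (constField γ) t ∈ graphIdeal n

/-- The horizontal letter adjoins `X_{U,V} S`. -/
@[simp] theorem image_H (U W : Vec n) (S : Set (MvPolynomial (GraphVars n) ℂ)) :
    (H U W).image S = hDer U W '' S := rfl

/-- The vertical letter adjoins `D_γ S`. -/
@[simp] theorem image_V (γ : Vec n) (S : Set (MvPolynomial (GraphVars n) ℂ)) :
    (V γ).image S = derivC (constField γ) '' S := rfl

/-- Horizontal letters are always legal. -/
@[simp] theorem legal_H (U W : Vec n) (S : Set (MvPolynomial (GraphVars n) ℂ)) : (H U W).Legal S := trivial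

/-- A vertical letter is legal iff its field is a kernel field of the stage. -/
theorem legal_V_iff (γ : Vec n) (S : Set (MvPolynomial (GraphVars n) ℂ)) :
    (V γ).Legal S ↔ ∀ t ∈ S, derivC (constField γ) t ∈ graphIdeal n := Iff.rfl

end FreeLetter

/-- The generating set reached by the FREE WORD `w` (letters applied in order):
`freeTowerSet S [] = S`, `freeTowerSet S (ℓ :: w) = freeTowerSet (S ∪ ℓ(S)) w`. -/
def freeTowerSet : Set (MvPolynomial (GraphVars n) ℂ) → List (FreeLetter n) → Set (MvPolynomial (GraphVars n) ℂ)
  | S, [] => S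
  | S, ℓ :: w => freeTowerSet (S ∪ ℓ.image S) w

/-- FREE TOWER: every letter is legal at the stage reached before it. -/
def IsFreeTower : Set (MvPolynomial (GraphVars n) ℂ) → List (FreeLetter n) → Prop
  | _, [] => True
  | S, ℓ :: w => ℓ.Legal S ∧ IsFreeTower (S ∪ ℓ.image S) w

/-- One more letter: pass to `S ∪ ℓ(S)`. -/
@[simp] theorem freeTowerSet_cons (S : Set (MvPolynomial (GraphVars n) ℂ)) (ℓ : FreeLetter n) (w : List (FreeLetter n)) :
    freeTowerSet S (ℓ :: w) = freeTowerSet (S ∪ ℓ.image S) w := rfl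

/-- Unfolding one letter of a free tower. -/
theorem isFreeTower_cons_iff (S : Set (MvPolynomial (GraphVars n) ℂ)) (ℓ : FreeLetter n) (w : List (FreeLetter n)) :
    IsFreeTower S (ℓ :: w) ↔ ℓ.Legal S ∧ IsFreeTower (S ∪ ℓ.image S) w := Iff.rfl

/-- Vertical-constant words are kernel towers along constant fields (M79 `towerSet`), and conversely. -/
theorem freeTowerSet_map_V (S : Set (MvPolynomial (GraphVars n) ℂ)) :
    ∀ γs : List (Vec n), freeTowerSet S (γs.map FreeLetter.V) = towerSet S (γs.map constField)
  | [] => rfl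
  | γ :: γs => by
    rw [List.map_cons, List.map_cons, freeTowerSet_cons, towerSet_cons, FreeLetter.image_V]
    exact freeTowerSet_map_V _ γs

/-- **THE FREE MIXED DIAL** `FreeReach D r K` (NODE-g49 §3.1): every correct system with tests of degree `≤ D`,
over every `n ≥ 1`, admits a FREE WORD of length `≤ r` (horizontal letters, vertical letters along CONSTANT kernel
fields) whose last stage is ideal-initially isolated to order `K` over SOME base pair.  No cost clause (both
letters are cost-free); the engine claim toward `EquationsForceMultiplicationDeg D` (gap B1) is NOT asserted. -/
def FreeReach (D r K : ℕ) : Prop :=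
  ∀ n : ℕ, 1 ≤ n → ∀ E : EqSystem n, E.Correct → E.IsDegLe D →
    ∃ w : List (FreeLetter n), w.length ≤ r ∧ IsFreeTower E.testSet w ∧
      ∃ y, IdealInitIsolatedSet (freeTowerSet E.testSet w) K y

/-- Monotone in the target order. -/
theorem FreeReach.mono_order {D r K K' : ℕ} (h : FreeReach D r K) (hKK' : K ≤ K') : FreeReach D r K' :=
  fun n hn E hE hD => by
    obtain ⟨w, hlen, hT, hiso⟩ := h n hn E hE hD
    exact ⟨w, hlen, hT, hiso.imp fun y hy => hy.mono_order hKK'⟩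

/-- **Length `0` is the order dial** (as for towers, M79 `towerReach_zero_iff`). -/
theorem freeReach_zero_iff {D K : ℕ} : FreeReach D 0 K ↔ DegreeBoundsIsoOrder D K :=
  ⟨fun h n hn E hE hD => by
    obtain ⟨w, hlen, -, y, hy⟩ := h n hn E hE hD
    obtain rfl : w = [] := List.eq_nil_of_length_eq_zero (Nat.le_zero.1 hlen)
    exact ⟨y, hy⟩,
  fun h n hn E hE hD => by obtain ⟨y, hy⟩ := h n hn E hE hD; exact ⟨[], le_rfl, trivial, y, hy⟩⟩

/-! ## Row tests under the two letters; the specimen `RP_e(n)` -/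

/-- Values of the base derivation `∂_{U,V}` of `ℂ[A,B]`: `a_e ↦ U_e`, `b_e ↦ V_e`. -/
def bField (U W : Vec n) : MatMulVars n → MvPolynomial (MatMulVars n) ℂ
  | Sum.inl v => C (U v)
  | Sum.inr w => C (W w)

/-- The base derivation `∂_{U,V}` of `ℂ[A,B]` (the restriction of `X_{U,V}` to `ℂ[A,B]`). -/
def bDer (U W : Vec n) : Derivation ℂ (MvPolynomial (MatMulVars n) ℂ) (MvPolynomial (MatMulVars n) ℂ) :=
  mkDerivation ℂ (bField U W)

/-- `∂_{U,V}` on a variable. -/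
theorem bDer_X (U W : Vec n) (v : MatMulVars n) : bDer U W (X v) = bField U W v := mkDerivation_X _ _ _

/-- `∂_{U,V}` kills constants. -/
theorem bDer_C (U W : Vec n) (a : ℂ) : bDer U W (C a : MvPolynomial (MatMulVars n) ℂ) = 0 :=
  (bDer U W).map_algebraMap a

/-- The base field is the restriction of the horizontal field. -/
theorem liftAB_bField (U W : Vec n) (v : MatMulVars n) : liftAB n (bField U W v) = hField U W (Sum.inl v) := by
  rcases v with v | w <;> simp only [bField, hField, liftAB_C]

/-- **`X_{U,V} ι(p) = ι(∂_{U,V} p)`** for `p ∈ ℂ[A,B]`. -/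
theorem hDer_liftAB (U W : Vec n) (p : MvPolynomial (MatMulVars n) ℂ) :
    hDer U W (liftAB n p) = liftAB n (bDer U W p) := by
  induction p using MvPolynomial.induction_on with
  | C a => rw [liftAB_C, hDer_C, bDer_C, map_zero]
  | add p q hp hq => rw [map_add, map_add, hp, hq, map_add, map_add]
  | mul_X p v hp =>
    rw [map_mul, liftAB_X, Derivation.leibniz, Derivation.leibniz, smul_eq_mul, smul_eq_mul, smul_eq_mul,
      smul_eq_mul, hp, hDer_X, bDer_X, map_add, map_mul, map_mul, liftAB_X, liftAB_bField]

/-- `X_{U,V}` kills every power of a generator. -/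
theorem hDer_generator_pow (U W : Vec n) (q : Fin n × Fin n) (e : ℕ) : hDer U W (generator n q ^ e) = 0 := by
  rw [Derivation.leibniz_pow, hDer_generator, smul_zero, smul_zero]

/-- The ROW TEST `row(ρ) := Σ_q ι(ρ_q) f_q` with coefficient row `ρ : q ↦ ρ_q ∈ ℂ[A,B]`. -/
def rowTest (ρ : Fin n × Fin n → MvPolynomial (MatMulVars n) ℂ) : MvPolynomial (GraphVars n) ℂ :=
  ∑ q, liftAB n (ρ q) * generator n q

/-- **`X_{U,V} row(ρ) = row(∂_{U,V} ρ)`**: the horizontal letter acts on the coefficient row only. -/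
theorem hDer_rowTest (U W : Vec n) (ρ : Fin n × Fin n → MvPolynomial (MatMulVars n) ℂ) :
    hDer U W (rowTest ρ) = rowTest fun q => bDer U W (ρ q) := by
  simp only [rowTest, map_sum, Derivation.leibniz, hDer_generator, smul_eq_mul, mul_zero, zero_add, hDer_liftAB]
  exact Finset.sum_congr rfl fun q _ => mul_comm _ _

/-- **`D_μ row(ρ) = ι(Σ_q μ_q ρ_q)`**: a vertical letter pairs the field with the row. -/
theorem derivC_rowTest (μ ρ : Fin n × Fin n → MvPolynomial (MatMulVars n) ℂ) :
    derivC μ (rowTest ρ) = liftAB n (∑ q, μ q * ρ q) := by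
  classical
  simp only [derivC, rowTest, map_sum, pderiv_mul, pderiv_inr_liftAB, zero_mul, zero_add,
    pderiv_inr_generator_eq_ite, mul_ite, mul_one, mul_zero, Finset.sum_ite_eq', Finset.mem_univ, if_true, map_mul]

/-- `lift_F row(ρ) = Σ_q ρ_q F_q` (linear in `F`). -/
theorem liftF_rowTest (ρ : Fin n × Fin n → MvPolynomial (MatMulVars n) ℂ) :
    liftF n (rowTest ρ) = ∑ q, C (ρ q) * X q := by
  simp only [rowTest, map_sum, map_mul, liftF_liftAB, liftF_generator]

/-- The PRIVATE PRODUCT `θ_q := a_q · b_q` — the `a`-variable and the `b`-variable AT the position `q`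
(so distinct positions have disjoint variables). -/
def rpTheta (n : ℕ) (q : Fin n × Fin n) : MvPolynomial (MatMulVars n) ℂ := X (Sum.inl q) * X (Sum.inr q)

/-- `Σ_q γ_q θ_q = 0` with CONSTANT `γ` forces `γ = 0` (evaluate at `a = δ_q`, `b ≡ 1`). -/
theorem eq_zero_of_sum_rpTheta (γ : Vec n) (h : ∑ q, C (γ q) * rpTheta n q = 0) : γ = 0 := by
  classical
  funext q
  have h' := congr_arg (MvPolynomial.eval (Sum.elim (fun q' => if q' = q then (1 : ℂ) else 0) fun _ => (1 : ℂ))) h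
  simpa [rpTheta, Finset.sum_ite_eq', eq_comm] using h'

/-- **A VERTICAL LETTER LEGAL ON THE THETA ROW IS ZERO**: `D_γ row(θ) = ι(Σ_q γ_q θ_q) ∈ I(Γ)` forces
`γ = 0` — the theta row has NO constant kernel field. -/
theorem eq_zero_of_legal_rowTest_rpTheta {γ : Vec n}
    (h : derivC (constField γ) (rowTest (rpTheta n)) ∈ graphIdeal n) : γ = 0 := by
  rw [derivC_rowTest, liftAB_mem_graphIdeal_iff] at h
  exact eq_zero_of_sum_rpTheta γ (by simpa only [constField] using h)

/-- The zero field adjoins nothing but `0`. -/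
theorem derivC_constField_zero (t : MvPolynomial (GraphVars n) ℂ) : derivC (constField (0 : Vec n)) t = 0 := by
  simp [derivC, constField]

/-- The SHAPE of every element of a free stage over `RP_e`: `0`, a power `f_q^e`, or a row test `row(ρ)`
with `ρ` in the finite list `R` of rows. -/
def RPGood (e : ℕ) (R : List (Fin n × Fin n → MvPolynomial (MatMulVars n) ℂ)) : Set (MvPolynomial (GraphVars n) ℂ) :=
  {t | t = 0 ∨ (∃ q, t = generator n q ^ e) ∨ ∃ ρ ∈ R, t = rowTest ρ}

/-- **THE FREE-STAGE INVARIANT OF `RP_e`**: along any free tower over a stage of shape `RPGood e R` containing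
the theta row, every stage has shape `RPGood e R'` with `|R'| ≤ 2^{length} · |R|` (a horizontal letter replaces
each row `ρ` by `ρ, ∂ρ` and kills the powers; a vertical letter is legal only for `γ = 0` and adjoins `0`). -/
theorem freeTowerSet_subset_rpGood (e : ℕ) :
    ∀ (w : List (FreeLetter n)) (S : Set (MvPolynomial (GraphVars n) ℂ))
      (R : List (Fin n × Fin n → MvPolynomial (MatMulVars n) ℂ)),
      rowTest (rpTheta n) ∈ S → S ⊆ RPGood e R → IsFreeTower S w →
        ∃ R' : List (Fin n × Fin n → MvPolynomial (MatMulVars n) ℂ),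
          R'.length ≤ 2 ^ w.length * R.length ∧ freeTowerSet S w ⊆ RPGood e R'
  | [], S, R, _, hS, _ => ⟨R, by simp, hS⟩
  | FreeLetter.H U W :: w, S, R, hθ, hS, hT => by
    have hS₁ : S ∪ (FreeLetter.H U W).image S ⊆ RPGood e (R ++ R.map fun ρ q => bDer U W (ρ q)) := by
      rintro t (ht | ⟨t, ht, rfl⟩)
      · rcases hS ht with h0 | ⟨q, hq⟩ | ⟨ρ, hρ, hρt⟩
        · exact Or.inl h0
        · exact Or.inr (Or.inl ⟨q, hq⟩)
        · exact Or.inr (Or.inr ⟨ρ, List.mem_append_left _ hρ, hρt⟩)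
      · rcases hS ht with rfl | ⟨q, rfl⟩ | ⟨ρ, hρ, rfl⟩
        · exact Or.inl (map_zero _)
        · exact Or.inl (hDer_generator_pow U W q e)
        · exact Or.inr (Or.inr ⟨fun q => bDer U W (ρ q), List.mem_append_right _ (List.mem_map.2 ⟨ρ, hρ, rfl⟩),
            hDer_rowTest U W ρ⟩)
    obtain ⟨R', hlen, hsub⟩ := freeTowerSet_subset_rpGood e w _ _ (Or.inl hθ) hS₁ hT.2
    refine ⟨R', hlen.trans ?_, hsub⟩
    rw [List.length_append, List.length_map, List.length_cons, pow_succ]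
    linarith
  | FreeLetter.V γ :: w, S, R, hθ, hS, hT => by
    have hγ : γ = 0 := eq_zero_of_legal_rowTest_rpTheta (hT.1 _ hθ)
    have hS₁ : S ∪ (FreeLetter.V γ).image S ⊆ RPGood e R := by
      rintro t (ht | ⟨t, -, rfl⟩)
      · exact hS ht
      · rw [hγ]; exact Or.inl (derivC_constField_zero t)
    obtain ⟨R', hlen, hsub⟩ := freeTowerSet_subset_rpGood e w _ R (Or.inl hθ) hS₁ hT.2
    refine ⟨R', hlen.trans ?_, hsub⟩
    rw [List.length_cons, pow_succ]
    have : 0 ≤ 2 ^ w.length * R.length := Nat.zero_le _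
    nlinarith

/-- Fewer than `n²` rows have a common kernel vector `u ≠ 0` at every base pair `y`. -/
theorem exists_common_kernel (y : MatMulVars n → ℂ) (R : List (Fin n × Fin n → MvPolynomial (MatMulVars n) ℂ))
    (hR : R.length < n * n) :
    ∃ u : Fin n × Fin n → ℂ, u ≠ 0 ∧ ∀ ρ ∈ R, ∑ q, MvPolynomial.eval y (ρ q) * u q = 0 := by
  let M : Matrix (Fin R.length) (Fin n × Fin n) ℂ := Matrix.of fun i q => MvPolynomial.eval y (R.get i q)
  have hlt : Module.finrank ℂ (Fin R.length → ℂ) < Module.finrank ℂ (Fin n × Fin n → ℂ) := by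
    simpa only [Module.finrank_fintype_fun_eq_card, Fintype.card_fin, Fintype.card_prod] using hR
  obtain ⟨u, hu, hu0⟩ := Submodule.exists_mem_ne_zero_of_ne_bot (LinearMap.ker_ne_bot_of_finrank_lt (f := M.mulVecLin) hlt)
  refine ⟨u, hu0, fun ρ hρ => ?_⟩
  obtain ⟨i, rfl⟩ := List.get_of_mem hρ
  have h := congr_fun (LinearMap.mem_ker.1 hu) i
  simpa [M, Matrix.mulVec, dotProduct] using h

/-- Along the jet field `γ_v = u_v X` with `u` a common kernel vector of the rows at `y`, every element
of `RPGood e R` is `O(X^e)`: `0 ↦ 0`, `f_q^e ↦ u_q^e X^e`, `row(ρ) ↦ (Σ_q ρ_q(y) u_q) X = 0`. -/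
theorem rpGood_jet_dvd {e : ℕ} (y : MatMulVars n → ℂ) (u : Fin n × Fin n → ℂ)
    (R : List (Fin n × Fin n → MvPolynomial (MatMulVars n) ℂ))
    (hu : ∀ ρ ∈ R, ∑ q, MvPolynomial.eval y (ρ q) * u q = 0)
    {t : MvPolynomial (GraphVars n) ℂ} (ht : t ∈ RPGood e R) :
    Polynomial.X ^ e ∣ aeval (fun v => Polynomial.C (u v) * Polynomial.X) (MvPolynomial.map (MvPolynomial.eval y) (liftF n t)) := by
  rcases ht with rfl | ⟨q, rfl⟩ | ⟨ρ, hρ, rfl⟩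
  · simp
  · refine ⟨Polynomial.C (u q ^ e), ?_⟩
    rw [map_pow, liftF_generator, map_pow, map_X, map_pow, aeval_X, mul_pow, ← Polynomial.C_pow, mul_comm]
  · refine ⟨0, ?_⟩
    rw [mul_zero, liftF_rowTest, map_sum, map_sum]
    simp only [map_mul, map_C, map_X, aeval_C, aeval_X, Polynomial.algebraMap_eq]
    calc ∑ q, Polynomial.C (MvPolynomial.eval y (ρ q)) * (Polynomial.C (u q) * Polynomial.X)
        = Polynomial.C (∑ q, MvPolynomial.eval y (ρ q) * u q) * Polynomial.X := by
          rw [map_sum, Finset.sum_mul]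
          exact Finset.sum_congr rfl fun q _ => by rw [map_mul]; ring
      _ = 0 := by rw [hu ρ hρ, map_zero, zero_mul]

/-- **NO FREE STAGE OF SHAPE `RPGood e R` WITH `|R| < n²` IS ISOLATED TO ORDER `< e`.** -/
theorem not_idealInitIsolatedSet_rpGood {e K : ℕ} (hKe : K < e)
    {R : List (Fin n × Fin n → MvPolynomial (MatMulVars n) ℂ)} (hR : R.length < n * n)
    {S : Set (MvPolynomial (GraphVars n) ℂ)} (hS : S ⊆ RPGood e R) (y : MatMulVars n → ℂ) :
    ¬ IdealInitIsolatedSet S K y := by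
  obtain ⟨u, hu0, hu⟩ := exists_common_kernel y R hR
  refine not_idealInitIsolatedSet_of_jetCert (fun v => Polynomial.C (u v) * Polynomial.X) (fun v => by simp) hKe
    (fun t ht => rpGood_jet_dvd y u R hu (hS ht)) ?_
  simpa using hu0

/-- The test list of `RP_e(n)`: the theta row, then the `e`-th powers of the generators. -/
def rpList (n e : ℕ) : List (MvPolynomial (GraphVars n) ℂ) :=
  rowTest (rpTheta n) :: (Finset.univ : Finset (Fin n × Fin n)).toList.map fun q => generator n q ^ e

/-- Membership in the test list. -/
theorem mem_rpList_iff {e : ℕ} {t : MvPolynomial (GraphVars n) ℂ} :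
    t ∈ rpList n e ↔ t = rowTest (rpTheta n) ∨ ∃ q, generator n q ^ e = t := by
  simp [rpList]

/-- The theta row has degree `≤ 4`. -/
theorem totalDegree_rowTest_rpTheta_le : (rowTest (rpTheta n)).totalDegree ≤ 4 := by
  refine (totalDegree_finsetSum _ _).trans (Finset.sup_le fun q _ => ?_)
  refine (totalDegree_mul _ _).trans ?_
  have h1 : (liftAB n (rpTheta n q)).totalDegree ≤ 2 := by
    rw [rpTheta, map_mul, liftAB_X, liftAB_X]
    exact (totalDegree_mul _ _).trans (add_le_add (totalDegree_X (R := ℂ) _).le (totalDegree_X (R := ℂ) _).le)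
  have h2 := totalDegree_generator_le_two n q
  omega

/-- **`RP_e(n)` REALISED** (`e ≥ 2`): a correct system of degree `≤ 2e` whose test set contains the theta
row and has shape `RPGood e [θ]`; it is isolated to order `e` at height `0` over every base pair (the powers,
M19b `EqSystem.idealInitIsolatedAt_of_generator_pow_mem`) — so the calibration below is tight for this specimen. -/
theorem exists_rpSystem {e : ℕ} (he : 2 ≤ e) : ∃ E : EqSystem n, E.Correct ∧ E.IsDegLe (2 * e) ∧
    rowTest (rpTheta n) ∈ E.testSet ∧ E.testSet ⊆ RPGood e [rpTheta n] ∧ ∀ y, E.IdealInitIsolatedAt e y := by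
  classical
  obtain ⟨E, hfan, hto, hfrom⟩ := exists_realisation_list (rpList n e)
  have hto' : ∀ j ∈ E.tests, E.testPoly j = rowTest (rpTheta n) ∨ ∃ q, generator n q ^ e = E.testPoly j :=
    fun j hj => mem_rpList_iff.1 (hto j hj)
  have hθ : ∃ j ∈ E.tests, E.testPoly j = rowTest (rpTheta n) := hfrom _ List.mem_cons_self
  have hpow : ∀ q, ∃ j ∈ E.tests, E.testPoly j = generator n q ^ e := fun q =>
    hfrom _ (mem_rpList_iff.2 (Or.inr ⟨q, rfl⟩))
  refine ⟨E, ⟨hfan, Set.ext fun x => ⟨fun hx => ?_, fun hx j hj => ?_⟩⟩, fun o => ?_, ?_, ?_,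
    E.idealInitIsolatedAt_of_generator_pow_mem (by omega) fun q => Ideal.subset_span ((E.mem_testSet_iff _).2 (hpow q))⟩
  · refine (mem_mmGraph_iff_eval_generator x).2 fun q => ?_
    obtain ⟨j, hj, hjq⟩ := hpow q
    have h := hx j hj
    rw [hjq, map_pow] at h
    exact (pow_eq_zero_iff (by omega)).1 h
  · have hg := (mem_mmGraph_iff_eval_generator x).1 hx
    rcases hto' j hj with hq | ⟨q, hq⟩
    · rw [hq, rowTest, map_sum]
      exact Finset.sum_eq_zero fun q _ => by rw [map_mul, hg q, mul_zero]
    · rw [← hq, map_pow, hg q, zero_pow (by omega)]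
  · rcases hto' _ (List.get_mem _ o) with hq | ⟨q, hq⟩
    · rw [hq]; exact totalDegree_rowTest_rpTheta_le.trans (by omega)
    · rw [← hq]
      have hg := totalDegree_generator_le_two n q
      exact (totalDegree_pow _ _).trans (by nlinarith)
  · exact (E.mem_testSet_iff _).2 hθ
  · intro t ht
    obtain ⟨j, hj, rfl⟩ := (E.mem_testSet_iff t).1 ht
    rcases hto' j hj with hq | ⟨q, hq⟩
    · exact Or.inr (Or.inr ⟨rpTheta n, List.mem_singleton.2 rfl, hq⟩)
    · exact Or.inr (Or.inl ⟨q, hq.symm⟩)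

/-- **THE POWER CALIBRATION OF THE FREE DIAL.**  For every `e ≥ 2` and EVERY word length `r`,
`FreeReach (2e) r (e − 1)` fails: over `n = 2^r + 1` the specimen `RP_e(n)` has, after any free word of
length `≤ r`, a stage of shape `RPGood e R'` with `|R'| ≤ 2^r < n²`, hence order `≥ e` at every base pair. -/
theorem not_freeReach_pow {e : ℕ} (he : 2 ≤ e) (r : ℕ) : ¬ FreeReach (2 * e) r (e - 1) := by
  intro h
  obtain ⟨E, hE, hdeg, hθ, hgood, -⟩ := exists_rpSystem (n := 2 ^ r + 1) he
  obtain ⟨w, hlen, hT, y, hy⟩ := h (2 ^ r + 1) (Nat.le_add_left 1 _) E hE hdeg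
  obtain ⟨R', hR', hsub⟩ := freeTowerSet_subset_rpGood e w E.testSet [rpTheta (2 ^ r + 1)] hθ hgood hT
  have hR'lt : R'.length < (2 ^ r + 1) * (2 ^ r + 1) := by
    have h1 : 2 ^ w.length ≤ 2 ^ r := Nat.pow_le_pow_right (by norm_num) hlen
    have h2 : R'.length ≤ 2 ^ r := by simpa using hR'.trans (by simpa using h1)
    nlinarith
  exact not_idealInitIsolatedSet_rpGood (show e - 1 < e by omega) hR'lt hsub y hy

/-- Every smaller target order fails as well. -/
theorem not_freeReach_pow_of_le {e K : ℕ} (he : 2 ≤ e) (hK : K ≤ e - 1) (r : ℕ) : ¬ FreeReach (2 * e) r K :=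
  fun h => not_freeReach_pow he r (h.mono_order hK)

/-- **`D = 4`, ORDER `1` IS DECIDED: `¬ FreeReach 4 r 1` for every `r`** (specimen `RP_2 = {Σ_q a_q b_q f_q} ∪ {f_q²}`).
The engine-relevant cell `FreeReach 4 r 2` is NOT decided here (`RP_2` is order-`2` isolated at height `0`). -/
theorem not_freeReach_four_one (r : ℕ) : ¬ FreeReach 4 r 1 := not_freeReach_pow (e := 2) le_rfl r

/-- Length `0` is dead at `D = 4` for EVERY order (M71 `not_degreeBoundsIsoOrder_four`): the open cells of the
`D = 4` table are exactly `FreeReach 4 r K` with `r ≥ 1` and `K ≥ 2`, the engine-relevant one being `K = 2`. -/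
theorem not_freeReach_four_length_zero (K : ℕ) : ¬ FreeReach 4 0 K :=
  fun h => not_degreeBoundsIsoOrder_four K (freeReach_zero_iff.1 h)

/-- **`D = 6`, ORDERS `≤ 2` ARE DECIDED: `¬ FreeReach 6 r 2` for every `r`** (hence every `K ≤ 2`, `mono_order`;
specimen `RP_3`): the free mixed alphabet cannot carry the `K ≤ 2` engine at any degree `D ≥ 6`. -/
theorem not_freeReach_six_two (r : ℕ) : ¬ FreeReach 6 r 2 := not_freeReach_pow (e := 3) (by norm_num) r

end Summit.MatrixMultiplication.MatrixMultiplication.Theorems.GraphEquations
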